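import Literature.Analysis.SpecialFunctions.Hyp0F1
import Mathlib.Analysis.Calculus.SmoothSeries
import Mathlib.Analysis.Calculus.Deriv.MeanValue
import Mathlib.Analysis.Calculus.Deriv.Slope
import Mathlib.Analysis.SpecialFunctions.Pow.Deriv
import Mathlib.Topology.Order.Monotone

/-!
# `₀F₁` calculus and Watson's elementary zero bounds `j_ν > ν`, `j′_ν > ν`

All statements are PROVED here from Mathlib and `Literature.Analysis.SpecialFunctions.Hyp0F1` (0 facts).
* Calculus of `hyp0F1 b z = ₀F₁(; b; z)` (`b > 0`) of `Literature/Analysis/SpecialFunctions/Hyp0F1.lean`: the term-wise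
  derivative `d/dz ₀F₁(; b; z) = ₀F₁(; b+1; z)/b` [DLMF §16.3 Eq. 16.3.1, `p = 0`, `q = 1`], continuity, the contiguous
  relation `₀F₁(; b; z) − ₀F₁(; b+1; z) = (z/(b(b+1))) ₀F₁(; b+2; z)` — under `J_ν(x) = (x/2)^ν/Γ(ν+1) ₀F₁(; ν+1; −x²/4)`
  [DLMF 10.16.9] this is Lommel's recurrence `J_{ν−1}(z) + J_{ν+1}(z) = (2ν/z) J_ν(z)` [Watson §3.2 (1)] — and, for the
  normalised Bessel function `ξ(α, x) = ₀F₁(; α+1; −x²/4) = Γ(α+1)(2/x)^α J_α(x)` of that file,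
  `d/dx ξ(α, x) = −(x/(2(α+1))) ξ(α+1, x)`, i.e. `d/dz {z^{−ν} J_ν(z)} = −z^{−ν} J_{ν+1}(z)` [Watson §3.2 (6), `m = 1`].
* WATSON §15.3 (1): for `ν > 0` the smallest positive zeros `j_ν` of `J_ν` and `j′_ν` of `J_ν′` satisfy `j_ν > ν`,
  `j′_ν > ν` — "so long as `0 < x < ν`, both `J_ν(x)` and `x J_ν′(x)` are positive increasing functions" — proved, as
  there, from the differential equation `x d/dx {x dJ_ν(x)/dx} = (ν² − x²) J_ν(x)` (cf. DLMF §10.21(i)). In the `ξ`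
  normalisation (no Gamma factors): `ξ(α, x) > 0` whenever `α > 0` and `|x| ≤ α` (`xi_pos_of_abs_le`), and
  `x ↦ (x/2)^α ξ(α, x) = Γ(α+1) J_α(x)` is strictly increasing on `[0, α]` (`strictMonoOn_rpow_mul_xi`); in the variable
  `y = x²/4`: `₀F₁(; b; −y) > 0` for `0 ≤ y ≤ (b−1)²/4` and `y ↦ y^{(b−1)/2} ₀F₁(; b; −y)` strictly increasing there (`b > 1`).

Proof architecture (Watson §15.3, first paragraph, in first-order quantities). With `G(y) = ₀F₁(; b; −y)` and
`H(y) = ₀F₁(; b+1; −y)`: `G′ = −H/b` and, by the contiguous relation, `y H′ = b (G − H)`. Watson's `x J_ν′(x)` is a positive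
multiple of `K(y) = (b−1) G(y) − (2/b) y H(y)` (`(y^{(b−1)/2} G)′ = ½ y^{(b−3)/2} K`), and `K′ = ((b−1)/b) H − 2G`. If `K` had a
first zero `y₁ < (b−1)²/4`, then `G > 0` on `[0, y₁]` (integrating factor `y^{(b−1)/2}`), `H(y₁) = b(b−1)G(y₁)/(2y₁)` and
`K′(y₁) = G(y₁)((b−1)² − 4y₁)/(2y₁) > 0`, contradicting `K > 0` to the left of `y₁`.
NOT here: the sharper bounds `√(ν(ν+2)) < j_ν < √(2(ν+1)(ν+3))` [Watson §15.3 (5)], existence of zeros, anything about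
`Y_ν`, and any bridge to the integer-order power series of `Literature/Analysis/FunctionSpaces/BesselJ.lean`.
-/
noncomputable section

open Filter Set Metric Topology

namespace Literature.Analysis.SpecialFunctions.Hyp0F1

/-- Front shift of Pochhammer's symbol: `(b)_{k+1} = b·(b+1)_k` (private: the same identity for an unrelated copy of
`poch` is landed elsewhere in the tree; importing that module here would be inappropriate). [cite: DLMF, §5.2(iii) Eq. 5.2.5] -/
private theorem poch_succ_left (b : ℝ) (k : ℕ) : poch b (k + 1) = b * poch (b + 1) k := by
  unfold poch
  rw [Finset.prod_range_succ', Nat.cast_zero, add_zero, mul_comm]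
  congr 1
  exact Finset.prod_congr rfl fun i _ => by push_cast; ring

/-- `b^k ≤ (b)_k` for `b > 0`. [folklore] -/
private theorem pow_le_poch_of_pos {b : ℝ} (hb : 0 < b) (k : ℕ) : b ^ k ≤ poch b k := by
  induction k with
  | zero => simp [poch]
  | succ k ih =>
      rw [pow_succ, poch_succ]
      exact mul_le_mul ih (by linarith) hb.le (poch_pos hb k).le

/-- `|z^k/(k!(b)_k)| ≤ (|z|/b)^k/k!` for `b > 0` (domination of the `₀F₁` term by the exponential term). [folklore] -/
private theorem abs_hyp0F1Term_le_pow_div_factorial {b : ℝ} (hb : 0 < b) (z : ℝ) (k : ℕ) :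
    |hyp0F1Term b z k| ≤ (|z| / b) ^ k / k.factorial := by
  unfold hyp0F1Term
  have hp := poch_pos hb k
  have hf : (0 : ℝ) < k.factorial := by positivity
  rw [abs_div, abs_pow, abs_of_pos (mul_pos hf hp), div_pow, div_div, mul_comm]
  apply div_le_div_of_nonneg_left (by positivity) (by positivity)
  exact mul_le_mul_of_nonneg_right (pow_le_poch_of_pos hb k) hf.le

/-- Each term is differentiable in `z`: `d/dz [z^k/(k!(b)_k)] = k z^{k−1}/(k!(b)_k)`. [folklore] -/
private theorem hasDerivAt_hyp0F1Term (b z : ℝ) (k : ℕ) :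
    HasDerivAt (fun w => hyp0F1Term b w k) ((k : ℝ) * z ^ (k - 1) / ((k.factorial : ℝ) * poch b k)) z := by
  unfold hyp0F1Term
  exact (hasDerivAt_pow k z).div_const _

/-- Index shift of the term derivative: `d/dz t_{k+1}(b, z) = t_k(b+1, z)/b` (by `(b)_{k+1} = b (b+1)_k`). [folklore] -/
private theorem deriv_hyp0F1Term_succ {b : ℝ} (hb : 0 < b) (z : ℝ) (k : ℕ) :
    (((k + 1 : ℕ) : ℝ) * z ^ (k + 1 - 1) / (((k + 1).factorial : ℝ) * poch b (k + 1)))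
      = hyp0F1Term (b + 1) z k / b := by
  rw [Nat.add_sub_cancel, Nat.factorial_succ, poch_succ_left, hyp0F1Term]
  push_cast
  have h1 : (k.factorial : ℝ) ≠ 0 := by positivity
  have h2 : poch (b + 1) k ≠ 0 := (poch_pos (by linarith) k).ne'
  have h3 : ((k : ℝ) + 1) ≠ 0 := by positivity
  field_simp

/-- Uniform domination of the term derivatives on `|w| ≤ R`: `|d/dw t_n(b, w)| ≤ (R/(b+1))^{n−1}/((n−1)! b)`. [folklore] -/
private theorem abs_deriv_hyp0F1Term_le {b R w : ℝ} (hb : 0 < b) (hw : |w| ≤ R) (n : ℕ) :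
    |(n : ℝ) * w ^ (n - 1) / ((n.factorial : ℝ) * poch b n)|
      ≤ (R / (b + 1)) ^ (n - 1) / (((n - 1).factorial : ℝ) * b) := by
  have hR : 0 ≤ R := (abs_nonneg w).trans hw
  rcases n with _ | k
  · simp only [Nat.cast_zero, zero_mul, zero_div, abs_zero]
    positivity
  · rw [deriv_hyp0F1Term_succ hb w k, abs_div, abs_of_pos hb, Nat.add_sub_cancel, ← div_div]
    apply div_le_div_of_nonneg_right _ hb.le
    calc |hyp0F1Term (b + 1) w k| ≤ (|w| / (b + 1)) ^ k / k.factorial :=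
          abs_hyp0F1Term_le_pow_div_factorial (by linarith) w k
      _ ≤ (R / (b + 1)) ^ k / k.factorial := by gcongr

/-- The series of term derivatives sums to `₀F₁(; b+1; z)/b`. [folklore] -/
private theorem hasSum_deriv_hyp0F1Term {b : ℝ} (hb : 0 < b) (z : ℝ) :
    HasSum (fun n : ℕ => (n : ℝ) * z ^ (n - 1) / ((n.factorial : ℝ) * poch b n)) (hyp0F1 (b + 1) z / b) := by
  have h1 : HasSum (fun k : ℕ => (((k + 1 : ℕ) : ℝ) * z ^ (k + 1 - 1) / (((k + 1).factorial : ℝ) * poch b (k + 1))))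
      (hyp0F1 (b + 1) z / b) := by
    have hfun : (fun k : ℕ => (((k + 1 : ℕ) : ℝ) * z ^ (k + 1 - 1) / (((k + 1).factorial : ℝ) * poch b (k + 1))))
        = fun k => hyp0F1Term (b + 1) z k / b := funext (deriv_hyp0F1Term_succ hb z)
    rw [hfun]
    exact (hasSum_hyp0F1 (by linarith) z).div_const b
  refine (hasSum_nat_add_iff' 1).mp ?_
  simpa using h1

/-- **`d/dz ₀F₁(; b; z) = ₀F₁(; b+1; z)/b`** for `b > 0`, by term-wise differentiation of the everywhere-convergent
series (term derivatives dominated on `|z| < R` by a convergent exponential series). [cite: DLMF, §16.3 Eq. 16.3.1] -/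
theorem hasDerivAt_hyp0F1 {b : ℝ} (hb : 0 < b) (z : ℝ) :
    HasDerivAt (hyp0F1 b) (hyp0F1 (b + 1) z / b) z := by
  set R : ℝ := |z| + 1 with hR
  have hu : Summable fun n : ℕ => (R / (b + 1)) ^ (n - 1) / (((n - 1).factorial : ℝ) * b) := by
    have h1 : Summable fun n : ℕ => (R / (b + 1)) ^ n / ((n.factorial : ℝ) * b) :=
      ((Real.summable_pow_div_factorial (R / (b + 1))).div_const b).congr fun n => by rw [div_div]
    exact (summable_nat_add_iff 1).mp (h1.congr fun n => by simp)
  have hz : z ∈ Ioo (-R) R := by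
    constructor <;> [linarith [neg_abs_le z]; linarith [le_abs_self z]]
  have key := hasDerivAt_tsum_of_isPreconnected (g := fun n w => hyp0F1Term b w n)
    (g' := fun n w => (n : ℝ) * w ^ (n - 1) / ((n.factorial : ℝ) * poch b n)) hu isOpen_Ioo
    isPreconnected_Ioo (fun n w _ => hasDerivAt_hyp0F1Term b w n)
    (fun n w hw => by
      rw [Real.norm_eq_abs]
      exact abs_deriv_hyp0F1Term_le hb (abs_lt.mpr hw).le n)
    hz (summable_hyp0F1Term hb z) hz
  rw [(hasSum_deriv_hyp0F1Term hb z).tsum_eq] at key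
  exact key

/-- `₀F₁(; b; ·)` is continuous on `ℝ` (`b > 0`). [cite: DLMF, §16.2(iii)] -/
theorem continuous_hyp0F1 {b : ℝ} (hb : 0 < b) : Continuous (hyp0F1 b) :=
  continuous_iff_continuousAt.mpr fun z => (hasDerivAt_hyp0F1 hb z).continuousAt

/-- Term identity behind the contiguous relation: `t_{k+1}(b) − t_{k+1}(b+1) = (z/(b(b+1))) t_k(b+2)`. [folklore] -/
private theorem hyp0F1Term_succ_sub_succ {b : ℝ} (hb : 0 < b) (z : ℝ) (k : ℕ) :
    hyp0F1Term b z (k + 1) - hyp0F1Term (b + 1) z (k + 1) = z / (b * (b + 1)) * hyp0F1Term (b + 2) z k := by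
  have hQpos : 0 < poch (b + 1) k := poch_pos (by linarith) k
  have hP : poch (b + 2) k = poch (b + 1) k * (b + 1 + k) / (b + 1) := by
    have h1 := poch_succ_left (b + 1) k
    rw [poch_succ, show b + 1 + 1 = b + 2 by ring] at h1
    rw [eq_div_iff (by positivity)]
    linarith
  have hf : (((k + 1).factorial : ℕ) : ℝ) = ((k : ℝ) + 1) * k.factorial := by
    rw [Nat.factorial_succ]; push_cast; ring
  have hFpos : (0 : ℝ) < k.factorial := by positivity
  unfold hyp0F1Term
  rw [poch_succ_left b k, poch_succ (b + 1) k, hP, hf]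
  -- abstract the two positive atoms before clearing denominators
  generalize poch (b + 1) k = Q at hQpos ⊢
  generalize (k.factorial : ℝ) = F at hFpos ⊢
  have h1 : F ≠ 0 := hFpos.ne'
  have h2 : Q ≠ 0 := hQpos.ne'
  have h3 : ((k : ℝ) + 1) ≠ 0 := by positivity
  have h4 : b + 1 + k ≠ 0 := by positivity
  have h5 : b + 1 ≠ 0 := by positivity
  have h6 : b ≠ 0 := hb.ne'
  field_simp
  ring

/-- **Contiguous relation** `₀F₁(; b; z) − ₀F₁(; b+1; z) = (z/(b(b+1))) ₀F₁(; b+2; z)` (`b > 0`); with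
`J_ν(x) = (x/2)^ν/Γ(ν+1) ₀F₁(; ν+1; −x²/4)` this is Lommel's `J_{ν−1}(z) + J_{ν+1}(z) = (2ν/z) J_ν(z)`.
[cite: Watson1944, §3.2 (1)] -/
theorem hyp0F1_sub_hyp0F1_succ {b : ℝ} (hb : 0 < b) (z : ℝ) :
    hyp0F1 b z - hyp0F1 (b + 1) z = z / (b * (b + 1)) * hyp0F1 (b + 2) z := by
  have hb1 : 0 < b + 1 := by linarith
  have hb2 : 0 < b + 2 := by linarith
  have hdiff : hyp0F1 b z - hyp0F1 (b + 1) z = ∑' k, (hyp0F1Term b z k - hyp0F1Term (b + 1) z k) :=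
    ((summable_hyp0F1Term hb z).tsum_sub (summable_hyp0F1Term hb1 z)).symm
  have hs : Summable fun k => hyp0F1Term b z (k + 1) - hyp0F1Term (b + 1) z (k + 1) := by
    simp_rw [hyp0F1Term_succ_sub_succ hb z]
    exact (summable_hyp0F1Term hb2 z).mul_left _
  rw [hdiff, tsum_eq_zero_add' (f := fun k => hyp0F1Term b z k - hyp0F1Term (b + 1) z k) hs]
  simp_rw [hyp0F1Term_succ_sub_succ hb z]
  rw [tsum_mul_left, hyp0F1Term_zero, hyp0F1Term_zero, sub_self, zero_add, hyp0F1]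

/-- `d/dy ₀F₁(; b; −y) = −₀F₁(; b+1; −y)/b`. [cite: DLMF, §16.3 Eq. 16.3.1] -/
theorem hasDerivAt_hyp0F1_neg {b : ℝ} (hb : 0 < b) (y : ℝ) :
    HasDerivAt (fun t => hyp0F1 b (-t)) (-(hyp0F1 (b + 1) (-y) / b)) y := by
  have h : HasDerivAt (fun t => hyp0F1 b (-t)) (hyp0F1 (b + 1) (-y) / b * -1) y :=
    (hasDerivAt_hyp0F1 hb (-y)).comp y (hasDerivAt_neg y)
  exact h.congr_deriv (by ring)

/-- `y · d/dy ₀F₁(; b+1; −y) = b (₀F₁(; b; −y) − ₀F₁(; b+1; −y))`: the contiguous relation as the second half of the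
first-order system for `(₀F₁(; b; −y), ₀F₁(; b+1; −y))`. [cite: Watson1944, §3.2 (1)] -/
theorem mul_deriv_hyp0F1_succ_neg {b : ℝ} (hb : 0 < b) (y : ℝ) :
    y * (-(hyp0F1 (b + 1 + 1) (-y) / (b + 1))) = b * (hyp0F1 b (-y) - hyp0F1 (b + 1) (-y)) := by
  rw [hyp0F1_sub_hyp0F1_succ hb (-y), show b + 1 + 1 = b + 2 by ring]
  have h1 : b + 1 ≠ 0 := by positivity
  have h2 : b ≠ 0 := hb.ne'
  field_simp

/-- **`d/dx ξ(α, x) = −(x/(2(α+1))) ξ(α+1, x)`** (`α > −1`), i.e. `d/dz {z^{−ν}J_ν(z)} = −z^{−ν}J_{ν+1}(z)`.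
[cite: Watson1944, §3.2 (6)] -/
theorem hasDerivAt_xi {α : ℝ} (hα : -1 < α) (x : ℝ) :
    HasDerivAt (xi α) (-(x / (2 * (α + 1))) * xi (α + 1) x) x := by
  have hb : 0 < α + 1 := by linarith
  have hin : HasDerivAt (fun t : ℝ => -(t ^ 2 / 4)) (-(((2 : ℕ) : ℝ) * x ^ (2 - 1) / 4)) x :=
    ((hasDerivAt_pow 2 x).div_const 4).neg
  have h : HasDerivAt (xi α) (hyp0F1 (α + 1 + 1) (-(x ^ 2 / 4)) / (α + 1) * -(((2 : ℕ) : ℝ) * x ^ (2 - 1) / 4)) x :=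
    (hasDerivAt_hyp0F1 hb (-(x ^ 2 / 4))).comp x hin
  refine h.congr_deriv ?_
  rw [xi]
  push_cast
  field_simp
  ring

/-- `ξ(α, ·)` is continuous (`α > −1`). [cite: DLMF, §10.16 Eq. 10.16.9] -/
theorem continuous_xi {α : ℝ} (hα : -1 < α) : Continuous (xi α) :=
  continuous_iff_continuousAt.mpr fun x => (hasDerivAt_xi hα x).continuousAt

/-! ### Watson §15.3 (1): positivity and monotonicity below the order -/

/-- Derivative of the integrating-factor product: `(t^e ₀F₁(; b; −t))′ = ½ t^{e−1} K(t)` at `t > 0`, `e = (b−1)/2`, with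
Watson's `K(t) = (b−1) ₀F₁(; b; −t) − (2/b) t ₀F₁(; b+1; −t)` (his `x J_ν′(x)` up to a positive factor). [folklore] -/
private theorem hasDerivAt_rpow_mul_hyp0F1_neg {b t : ℝ} (hb : 0 < b) (ht : 0 < t) :
    HasDerivAt (fun y : ℝ => y ^ ((b - 1) / 2) * hyp0F1 b (-y))
      (1 / 2 * t ^ ((b - 1) / 2 - 1) * ((b - 1) * hyp0F1 b (-t) - 2 / b * t * hyp0F1 (b + 1) (-t))) t := by
  have h := (Real.hasDerivAt_rpow_const (p := (b - 1) / 2) (Or.inl ht.ne')).mul (hasDerivAt_hyp0F1_neg hb t)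
  refine h.congr_deriv ?_
  have hsplit : t ^ ((b - 1) / 2) = t ^ ((b - 1) / 2 - 1) * t := by
    rw [Real.rpow_sub_one ht.ne']; field_simp
  rw [hsplit]
  have h2 : b ≠ 0 := hb.ne'
  field_simp
  ring

/-- The integrating-factor step (Watson: "so long as `J_ν(x)` is positive … `J_ν(x)` increases with `x`"): if
`K ≥ 0` on `(0, y₁)` then `₀F₁(; b; −y) > 0` on `[0, y₁]` (`b > 1`). [cite: Watson1944, §15.3 (1)] -/
theorem hyp0F1_neg_pos_of_nonneg {b y₁ : ℝ} (hb : 1 < b)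
    (hK : ∀ y ∈ Ioo 0 y₁, 0 ≤ (b - 1) * hyp0F1 b (-y) - 2 / b * y * hyp0F1 (b + 1) (-y)) :
    ∀ y ∈ Icc 0 y₁, 0 < hyp0F1 b (-y) := by
  have hb0 : 0 < b := by linarith
  have hG0 : 0 < hyp0F1 b (-(0 : ℝ)) := by rw [neg_zero, hyp0F1_zero_right hb0]; exact one_pos
  have hcont : Continuous fun t : ℝ => hyp0F1 b (-t) := (continuous_hyp0F1 hb0).comp continuous_neg
  obtain ⟨δ, hδ, hball⟩ : ∃ δ > 0, ∀ t ∈ ball (0 : ℝ) δ, 0 < hyp0F1 b (-t) :=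
    eventually_nhds_iff_ball.mp ((hcont.tendsto 0).eventually (lt_mem_nhds hG0))
  have hnear : ∀ t : ℝ, 0 ≤ t → t < δ → 0 < hyp0F1 b (-t) := fun t ht0 htδ =>
    hball t (by rw [mem_ball_zero_iff, Real.norm_eq_abs, abs_of_nonneg ht0]; exact htδ)
  intro y ⟨hy0, hyy₁⟩
  by_cases hyδ : y < δ
  · exact hnear y hy0 hyδ
  have hypos : 0 < y := lt_of_lt_of_le hδ (not_lt.mp hyδ)
  -- `Φ(t) = t^e ₀F₁(; b; −t)` is non-decreasing on `[δ/2, y]`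
  have hmono : MonotoneOn (fun t : ℝ => t ^ ((b - 1) / 2) * hyp0F1 b (-t)) (Icc (δ / 2) y) := by
    refine monotoneOn_of_hasDerivWithinAt_nonneg (convex_Icc _ _)
      (fun t ht => (hasDerivAt_rpow_mul_hyp0F1_neg hb0 (by linarith [ht.1])).continuousAt.continuousWithinAt)
      (fun t ht => (hasDerivAt_rpow_mul_hyp0F1_neg hb0
        (by rw [interior_Icc] at ht; linarith [ht.1])).hasDerivWithinAt) ?_
    intro t ht
    rw [interior_Icc] at ht
    have ht0 : 0 < t := by linarith [ht.1]
    have hKt := hK t ⟨ht0, lt_of_lt_of_le ht.2 hyy₁⟩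
    have : 0 < t ^ ((b - 1) / 2 - 1) := Real.rpow_pos_of_pos ht0 _
    positivity
  have hle := hmono ⟨le_rfl, by linarith⟩ ⟨by linarith, le_rfl⟩ (by linarith : δ / 2 ≤ y)
  have hΦδ : 0 < (δ / 2) ^ ((b - 1) / 2) * hyp0F1 b (-(δ / 2)) :=
    mul_pos (Real.rpow_pos_of_pos (by linarith) _) (hnear (δ / 2) (by linarith) (by linarith))
  exact (mul_pos_iff_of_pos_left (Real.rpow_pos_of_pos hypos _)).mp (lt_of_lt_of_le hΦδ hle)

/-- Watson's `x J_ν′(x) > 0` for `0 < x < ν`, in the variable `y = x²/4` and the `ξ` normalisation: for `b > 1`,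
`K(y) = (b−1) ₀F₁(; b; −y) − (2/b) y ₀F₁(; b+1; −y) > 0` for `0 ≤ y < (b−1)²/4`. [cite: Watson1944, §15.3 (1)] -/
theorem watsonK_pos {b : ℝ} (hb : 1 < b) :
    ∀ y ∈ Ico 0 ((b - 1) ^ 2 / 4), 0 < (b - 1) * hyp0F1 b (-y) - 2 / b * y * hyp0F1 (b + 1) (-y) := by
  have hb0 : 0 < b := by linarith
  have hb1 : 0 < b + 1 := by linarith
  set K : ℝ → ℝ := fun t => (b - 1) * hyp0F1 b (-t) - 2 / b * t * hyp0F1 (b + 1) (-t) with hKdef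
  have hK' : ∀ t, HasDerivAt K ((b - 1) / b * hyp0F1 (b + 1) (-t) - 2 * hyp0F1 b (-t)) t := by
    intro t
    have h : HasDerivAt (fun s => (b - 1) * hyp0F1 b (-s) - 2 / b * s * hyp0F1 (b + 1) (-s))
        ((b - 1) * (-(hyp0F1 (b + 1) (-t) / b))
          - (2 / b * 1 * hyp0F1 (b + 1) (-t) + 2 / b * t * (-(hyp0F1 (b + 1 + 1) (-t) / (b + 1))))) t :=
      ((hasDerivAt_hyp0F1_neg hb0 t).const_mul (b - 1)).sub
        (((hasDerivAt_id' t).const_mul (2 / b)).mul (hasDerivAt_hyp0F1_neg hb1 t))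
    refine h.congr_deriv ?_
    have hc : 2 / b * t * (-(hyp0F1 (b + 1 + 1) (-t) / (b + 1))) = 2 * (hyp0F1 b (-t) - hyp0F1 (b + 1) (-t)) := by
      rw [mul_assoc, mul_deriv_hyp0F1_succ_neg hb0 t]
      field_simp
    rw [hc]
    field_simp
    ring
  have hKcont : Continuous K := continuous_iff_continuousAt.mpr fun t => (hK' t).continuousAt
  have hK0 : K 0 = b - 1 := by simp only [hKdef, neg_zero, hyp0F1_zero_right hb0]; ring
  intro y₀ ⟨hy₀0, hy₀Y⟩
  by_contra hneg
  rw [not_lt] at hneg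
  -- the first point `y₁ ≤ y₀` where `K ≤ 0`
  set S : Set ℝ := Icc 0 y₀ ∩ {t | K t ≤ 0} with hS
  have hSc : IsClosed S := isClosed_Icc.inter (isClosed_le hKcont continuous_const)
  have hSbdd : BddBelow S := ⟨0, fun t ht => ht.1.1⟩
  have hy₁S : sInf S ∈ S := hSc.csInf_mem ⟨y₀, ⟨hy₀0, le_rfl⟩, hneg⟩ hSbdd
  set y₁ := sInf S with hy₁
  have hy₁0 : 0 ≤ y₁ := hy₁S.1.1
  have hbelow : ∀ t, 0 ≤ t → t < y₁ → 0 < K t := by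
    intro t ht0 hty₁
    by_contra hle
    rw [not_lt] at hle
    exact not_le.mpr hty₁ (csInf_le hSbdd ⟨⟨ht0, by linarith [hy₁S.1.2]⟩, hle⟩)
  have hKy₁le : K y₁ ≤ 0 := hy₁S.2
  have hy₁pos : 0 < y₁ := by
    rcases hy₁0.eq_or_lt with h | h
    · rw [← h, hK0] at hKy₁le; linarith
    · exact h
  -- `K y₁ = 0` (continuity from the left), `G y₁ > 0`, hence `K′(y₁) > 0`
  have hKy₁ : K y₁ = 0 := by
    have ht : Tendsto K (𝓝[<] y₁) (𝓝 (K y₁)) := tendsto_nhdsWithin_of_tendsto_nhds (hKcont.tendsto y₁)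
    refine le_antisymm hKy₁le (ge_of_tendsto ht ?_)
    filter_upwards [Ioo_mem_nhdsLT hy₁pos] with t ht
    exact (hbelow t ht.1.le ht.2).le
  have hGpos : 0 < hyp0F1 b (-y₁) :=
    hyp0F1_neg_pos_of_nonneg hb (fun t ht => (hbelow t ht.1.le ht.2).le) y₁ ⟨hy₁0, le_rfl⟩
  -- abstract the two values `G = ₀F₁(; b; −y₁) > 0`, `H = ₀F₁(; b+1; −y₁)`
  have hK'y := hK' y₁
  generalize hGdef : hyp0F1 b (-y₁) = G at hGpos hK'y
  generalize hHdef : hyp0F1 (b + 1) (-y₁) = H at hK'y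
  have h0 : (b - 1) * G - 2 / b * y₁ * H = 0 := by rw [← hGdef, ← hHdef]; exact hKy₁
  have hHy₁ : H = b * ((b - 1) * G) / (2 * y₁) := by
    have h2 : b ≠ 0 := hb0.ne'
    rw [eq_div_iff (by positivity)]
    field_simp at h0
    linarith
  have hderiv_pos : 0 < (b - 1) / b * H - 2 * G := by
    have hre : (b - 1) / b * H - 2 * G = G * ((b - 1) ^ 2 - 4 * y₁) / (2 * y₁) := by
      rw [hHy₁]
      have h2 : b ≠ 0 := hb0.ne'
      have h3 : y₁ ≠ 0 := hy₁pos.ne'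
      field_simp
      ring
    rw [hre]
    exact div_pos (mul_pos hGpos (by linarith [hy₁S.1.2])) (by linarith)
  -- but the slope of `K` from the left at `y₁` is `≤ 0`
  have hderiv_nonpos : (b - 1) / b * H - 2 * G ≤ 0 := by
    have hslope : Tendsto (slope K y₁) (𝓝[<] y₁) (𝓝 ((b - 1) / b * H - 2 * G)) :=
      (hasDerivWithinAt_iff_tendsto_slope' self_notMem_Iio).mp hK'y.hasDerivWithinAt
    refine le_of_tendsto hslope ?_
    filter_upwards [Ioo_mem_nhdsLT hy₁pos] with t ht
    rw [slope_def_field, hKy₁, sub_zero]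
    exact div_nonpos_of_nonneg_of_nonpos (hbelow t ht.1.le ht.2).le (by linarith [ht.2])
  linarith

/-- **`₀F₁(; b; −y) > 0` for `0 ≤ y ≤ (b−1)²/4`** (`b > 1`), i.e. `J_ν(x) > 0` for `0 < x ≤ ν` — Watson's `j_ν > ν`.
[cite: Watson1944, §15.3 (1)] -/
theorem hyp0F1_neg_pos_of_le {b y : ℝ} (hb : 1 < b) (hy0 : 0 ≤ y) (hy : y ≤ (b - 1) ^ 2 / 4) :
    0 < hyp0F1 b (-y) :=
  hyp0F1_neg_pos_of_nonneg hb (fun t ht => (watsonK_pos hb t ⟨ht.1.le, lt_of_lt_of_le ht.2 hy⟩).le) y ⟨hy0, le_rfl⟩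

/-- **`y ↦ y^{(b−1)/2} ₀F₁(; b; −y)` is strictly increasing on `[0, (b−1)²/4]`** (`b > 1`), i.e. `J_ν` increases on
`[0, ν]` — Watson's `j′_ν > ν`. [cite: Watson1944, §15.3 (1)] -/
theorem strictMonoOn_rpow_mul_hyp0F1_neg {b : ℝ} (hb : 1 < b) :
    StrictMonoOn (fun y : ℝ => y ^ ((b - 1) / 2) * hyp0F1 b (-y)) (Icc 0 ((b - 1) ^ 2 / 4)) := by
  have hb0 : 0 < b := by linarith
  have hcont : ContinuousOn (fun y : ℝ => y ^ ((b - 1) / 2) * hyp0F1 b (-y)) (Icc 0 ((b - 1) ^ 2 / 4)) :=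
    ((Real.continuous_rpow_const (by linarith)).mul ((continuous_hyp0F1 hb0).comp continuous_neg)).continuousOn
  refine strictMonoOn_of_hasDerivWithinAt_pos (convex_Icc _ _) hcont
    (fun t ht => (hasDerivAt_rpow_mul_hyp0F1_neg hb0 (by rw [interior_Icc] at ht; exact ht.1)).hasDerivWithinAt) ?_
  intro t ht
  rw [interior_Icc] at ht
  have h1 : 0 < t ^ ((b - 1) / 2 - 1) := Real.rpow_pos_of_pos ht.1 _
  have h2 := watsonK_pos hb t ⟨ht.1.le, ht.2⟩
  positivity

/-- **`ξ(α, x) > 0` whenever `α > 0` and `|x| ≤ α`**: `J_α` has no zero in `(0, α]` (`j_α > α`).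
[cite: Watson1944, §15.3 (1)] -/
theorem xi_pos_of_abs_le {α x : ℝ} (hα : 0 < α) (hx : |x| ≤ α) : 0 < xi α x := by
  have hsq : x ^ 2 ≤ α ^ 2 := by
    rw [← sq_abs]; exact pow_le_pow_left₀ (abs_nonneg x) hx 2
  have h := hyp0F1_neg_pos_of_le (b := α + 1) (y := x ^ 2 / 4) (by linarith) (by positivity)
    (by rw [show α + 1 - 1 = α by ring]; linarith)
  simpa [xi] using h

/-- **`x ↦ (x/2)^α ξ(α, x) = Γ(α+1) J_α(x)` is strictly increasing on `[0, α]`** (`α > 0`): `J_α′ > 0` on `(0, α)`,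
`j′_α > α`. [cite: Watson1944, §15.3 (1)] -/
theorem strictMonoOn_rpow_mul_xi {α : ℝ} (hα : 0 < α) :
    StrictMonoOn (fun x : ℝ => (x / 2) ^ α * xi α x) (Icc 0 α) := by
  have hsq : StrictMonoOn (fun x : ℝ => x ^ 2 / 4) (Icc 0 α) := by
    intro x hx y hy hxy
    have : x ^ 2 < y ^ 2 := pow_lt_pow_left₀ hxy hx.1 two_ne_zero
    show x ^ 2 / 4 < y ^ 2 / 4
    linarith
  have hmaps : MapsTo (fun x : ℝ => x ^ 2 / 4) (Icc 0 α) (Icc 0 ((α + 1 - 1) ^ 2 / 4)) := by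
    intro x hx
    refine ⟨by positivity, ?_⟩
    have : x ^ 2 ≤ α ^ 2 := pow_le_pow_left₀ hx.1 hx.2 2
    rw [show α + 1 - 1 = α by ring]
    linarith
  refine ((strictMonoOn_rpow_mul_hyp0F1_neg (b := α + 1) (by linarith)).comp hsq hmaps).congr fun x hx => ?_
  have hx2 : (0 : ℝ) ≤ x / 2 := by linarith [hx.1]
  have hpow : (x ^ 2 / 4) ^ ((α + 1 - 1) / 2) = (x / 2) ^ α := by
    rw [show x ^ 2 / 4 = (x / 2) ^ 2 by ring, ← Real.rpow_natCast (x / 2) 2, ← Real.rpow_mul hx2]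
    congr 1
    push_cast
    ring
  simp only [Function.comp_apply, xi, hpow]

end Literature.Analysis.SpecialFunctions.Hyp0F1

end
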